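import Summits.BirchSwinnertonDyer.BirchSwinnertonDyer.Theorems.SylvesterTwoHeegnerIndexYinDivisibilityIndex
import Summits.BirchSwinnertonDyer.BirchSwinnertonDyer.Theorems.SylvesterTwoHeegnerIndexLowerSplit
import HarnessLib

/-!
# Route `SylvesterTwoHeegnerIndex` (rung K7t): the LOWER cruxes 19891 `LowerOnV0HSY` / 19892
# `LowerOffV0HSY` RE-TYPED in Yin's SINGLE-CURVE point-divisibility currency — crux decls BY NAME,
# both directions (lossless); part I of II (part II `…YinUpperRung`: the UPPER crux and the rung)

Cell `bsd-cm`, seat `bsd-cm-k7t-c2` (prover-bsd-cm-k7t-c2-g9-0). PARTITION (D-0054): CornerF at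
`p = 2` (B14/O12) × 𝒞_HSY (both residue classes) × `p = 2` — types-the-object-of (kernel re-typing,
`--supports stmt-BirchSwinnertonDyer-19892`); closes no cell and no item; BSD is not claimed.
Everything here is PROVED: no definition, no named fact, no `sorry`. The two RESIDUALS are DISPLAYED
HYPOTHESES (verbatim in the signatures; nothing asserted about them):

* **(low)** — granted `PublishedFactsTwo`: for every 𝒞_HSY prime `p`, every minimal `B ≅ E_p` with
  `#Ш_an(B) = qB`, every quadratic `K ∋ ω`, every rational generator `P₀` (`ι`-form), every `Y ∈ B(K)`
  and `2`-adic unit `u` in Yin's display position `(u·qB)·ĥ_K(ι P₀) = 2^{2δ}·ĥ_K(Y)` (`2δ = 0 | −2`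
  for `p ≡ 4 | 7 (9)`), and every `j`: `Y ∈ 2^j·B(K) + tors ⟹ 2j + 2δ ≤ ord₂ #Ш(B)[2^∞]`
  («Yin's point `Z_p` is NOT TOO `2`-divisible»: on {`Ш(E_p)[2] = 0`} it reads «`Z_p` is
  `2`-PRIMITIVE» for `p ≡ 4 (9)` and «`Z_p ∉ 4E_p(K) + tors`» for `p ≡ 7 (9)`);
* **(up)** — granted `PublishedFactsTwoPlus`: same binders, `∃ j, Y ∈ 2^j·B(K) + tors ∧
  ord₂ #Ш(B)[2^∞] ≤ 2j + 2δ` («`Z_p` IS `2`-divisible ENOUGH»; its first bit on `p ≡ 7 (9)` is C′).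

THEOREMS (granted Yin's display `SylvesterTwoYin.YinHeightDisplay` — arXiv:2607.01744 Thm. 1.1 +
(3.5.3), PREPRINT, hypothesis shape of `…YinDefs`):
* §1 LOWER: `lowerOfFacts_of_yin_of_low` (19477 `HeegnerIndexLowerAtTwoHSYOfFacts` BY NAME),
  `lowerOnV0HSY_of_yin_of_low` / `lowerOffV0HSY_of_yin_of_low` (the LIVE children 19891 / 19892 BY
  NAME), and the converse `low_of_lowerOfFacts_of_yin`; so **`lowerOfFacts_iff_low_of_yin`**: modulo
  the display, the LOWER crux IS (low) — a kernel certificate for re-registering the residue stubs of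
  19891/19892 in Yin currency (planner g21's note in their skeleton docstrings), with the twin `E_{3p²}`
  and the `𝒱₀` / residue case-splits gone.
* (part II, `…YinUpperRung.lean`) §2 UPPER: 19725 / 19804 / 19802 BY NAME from (up) and back;
  §3 RUNG: granted `PublishedFactsTwoPlus` and the display, the leaf `X12.CMAtTwo` ⟺ (low) ∧ (up) —
  `BSD(E_p, 2)` on 𝒞_HSY says ONE explicit point per `p` has `2`-divisibility index EXACTLY
  `ord₂ #Ш(E_p)[2^∞]/2 − δ` in `E_p(ℚ(√−3))/tors` (memo two Thm B (iii), single curve, kernel).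

HONEST READING. Nothing is closed: (low) is the main-conjecture direction at the inert prime `2` of
`ℤ[ω]` (no mechanism in print — memo two §22.3; per-member it is certified on the k7t-c3 census rows),
(up) beyond its first bit is the Kolyvagin direction (line offv0-kolyvagin2 DEAD for it, D157). The
file only moves the K7t cruxes into the currency in which a future mechanism (a Jochnowitz /
Bertolini–Darmon-type evaluation of ONE Kummer class, or a `2`-adic Gross–Zagier formula at inert `2`)
would have to be stated, and proves that nothing is lost or added in the move.

## References
* H. Yin, arXiv:2607.01744 (2026), Thm. 1.1, (3.5.3), Thm. 2.2, p. 12 (PREPRINT).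
* Y. Hu, J. Shu, H. Yin, Trans. AMS 372 (2019) = arXiv:1708.05266, Thm. 1.3/1.4, pp. 8, 12.
* R. L. Miller, LMS J. Comput. Math. 14 (2011), §1 and Def. 1.1.
* A. Burungale, M. Flach, Camb. J. Math. 12 (2024), Thm. 1.1, Cor. 2 (the twin's BSD, via `pair_shaAn_two`).
* MEMO bsd-cm-two v2.11 §15.2, §22, §46–§47; parents p471972 (`…LowerSplit`), p478097 (`…YinIndex`),
  p418375 / p417655 (content of the halves), this seat's `…YinDivisibilityIndex`.
-/

set_option autoImplicit false
-- the Summit-side namespace `Summit.BirchSwinnertonDyer.BirchSwinnertonDyer.…` (summit = problem) is mandated by D-0017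
set_option linter.dupNamespace false

noncomputable section

open scoped Classical

open WeierstrassCurve WeierstrassCurve.Affine WeierstrassCurve.Affine.Point
  Summit.BirchSwinnertonDyer.BirchSwinnertonDyer.Theorems.SylvesterTwoCMNormForm
  Summit.BirchSwinnertonDyer.BirchSwinnertonDyer.Theorems.SylvesterTwoNonneg
  Summit.BirchSwinnertonDyer.BirchSwinnertonDyer.Theorems.SylvesterTwoThmCAssembly
  Literature.NumberTheory.EllipticCurves Literature.NumberTheory.EllipticCurves.HuShuYin2019
  Literature.NumberTheory.EllipticCurves.Rank1Residual.Typed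

namespace Summit.BirchSwinnertonDyer.BirchSwinnertonDyer.Theorems.SylvesterTwoYinLower

/-! ## §0 Bookkeeping: `ord₂ #Ш(B) = ord₂ #Ш(B)[2^∞]` on 𝒞_HSY (Hu–Shu–Yin: `Ш(E_p)` is finite) -/

/-- On a 𝒞_HSY member (a minimal partner `A ≅ E_{3p²}` always exists, `SylvesterTwoLowerSplit.exists_partner`),
`Ш(B)` is finite by Hu–Shu–Yin Thm 1.3, so Miller's `ord₂ #Ш(B)` equals `ord₂ #Ш(B)[2^∞]`.
[cite: HuShuYin2019, Thm. 1.3 and Thm. 1.4 (p. 3)] [cite: Miller2011LMS, Def. 1.1] -/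
theorem padicValNat_shaOrder_eq_primaryComponent (hHSY : thm14_threePart_product) {p : ℕ}
    (hp : p.Prime) (h9 : p % 9 = 4 ∨ p % 9 = 7) (h3 : ¬ ∃ x : ZMod p, x ^ 3 = 3)
    (B : WeierstrassCurve ℚ) [B.IsElliptic] [B.IsGloballyMinimal]
    (hB : ∃ C : VariableChange ℚ, C • B = cubeSumCurve (p : ℚ)) :
    padicValNat 2 B.shaOrder = padicValNat 2 (Nat.card (AddCommGroup.primaryComponent B.sha 2)) := by
  haveI : Fact (2 : ℕ).Prime := ⟨Nat.prime_two⟩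
  obtain ⟨A, _, _, CA, hCA⟩ := SylvesterTwoLowerSplit.exists_partner hp
  obtain ⟨-, -, hfinB, -⟩ := hHSY p hp h9 h3 A B hB ⟨CA, hCA⟩
  haveI : Finite B.sha := hfinB
  rw [WeierstrassCurve.shaOrder, padicValNat_card_addPrimaryComponent]

/-! ## §1 LOWER: items 19477 / 19891 / 19892 BY NAME from (low), and back -/

/-- **19477 `HeegnerIndexLowerAtTwoHSYOfFacts` ⟸ Yin's display + (low).** Granted `YinHeightDisplay`
(PREPRINT shape) and the displayed single-curve residual (low) (module docstring): the LOWER crux of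
K7t, i.e. (p417655 / `SylvesterTwoLowerCert.lowerOfFacts_iff_forall_missingLowerBoundAt`) granted
`PublishedFactsTwo`, `MissingLowerBoundAt B 2` for every minimal model of every member. Proof: at
`K = ℚ(ζ₃)` the display supplies `(qB, P, Y, u)`; `…YinDivisibilityIndex`'s
`missingLowerBoundAt_two_iff_forall_powDivisible_le` turns the goal into (low)'s conclusion (with §0).
A REDUCTION; (low) is open. [cite: Miller2011LMS, §1 and Def. 1.1] [cite: HuShuYin2019, Thm. 1.3 / 1.4, pp. 8, 12] -/
theorem lowerOfFacts_of_yin_of_low (hY : SylvesterTwoYin.YinHeightDisplay)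
    (hlow : Theses.SylvesterTwoHeegnerIndex.PublishedFactsTwo →
      ∀ (p : ℕ), p.Prime → (p % 9 = 4 ∨ p % 9 = 7) → (¬ ∃ x : ZMod p, x ^ 3 = 3) →
      ∀ (B : WeierstrassCurve ℚ) [B.IsElliptic] [B.IsGloballyMinimal],
        (∃ C : VariableChange ℚ, C • B = cubeSumCurve (p : ℚ)) → ∀ (qB : ℚ), shaAn B = (qB : ℂ) →
      ∀ (K : Type) [Field K] [NumberField K] (ω : K), ω ^ 2 + ω + 1 = 0 → Module.finrank ℚ K = 2 →
      ∀ (P₀ : B.toAffine.Point), ¬ IsOfFinAddOrder (QuadraticDescent.incl K B P₀) →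
        (∀ Q : B.toAffine.Point, ∃ m : ℤ,
          IsOfFinAddOrder (QuadraticDescent.incl K B Q - m • QuadraticDescent.incl K B P₀)) →
      ∀ (Y : (B.baseChange K).toAffine.Point) (u : ℚ), u ≠ 0 → padicValRat 2 u = 0 →
        ((u * qB : ℚ) : ℝ) * canonicalHeight (QuadraticDescent.incl K B P₀) =
          (2 : ℝ) ^ (if p % 9 = 4 then (0 : ℤ) else -2) * canonicalHeight Y →
      ∀ j : ℕ, (∃ Y' T' : (B.baseChange K).toAffine.Point,
          IsOfFinAddOrder T' ∧ Y = ((2 : ℤ) ^ j) • Y' + T') →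
        2 * (j : ℤ) + (if p % 9 = 4 then (0 : ℤ) else -2) ≤
          (padicValNat 2 (Nat.card (AddCommGroup.primaryComponent B.sha 2)) : ℤ)) :
    Theses.SylvesterTwoHeegnerIndex.HeegnerIndexLowerAtTwoHSYOfFacts := by
  refine SylvesterTwoLowerCert.lowerOfFacts_iff_forall_missingLowerBoundAt.mpr
    fun hF p hp h9 h3 B _ _ hB => ?_
  have hF' := hF
  obtain ⟨hHSY, -⟩ := hF'
  obtain ⟨ω, hω⟩ := exists_omega_cyclotomicField_three
  have h2K := finrank_cyclotomicField_three
  obtain ⟨qB, hqB, hq0, hrank, P, Y, u, hu0, hu, hP, hgen, hid⟩ :=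
    hY p hp h9 B hB (CyclotomicField 3 ℚ) ω hω h2K
  have hp2 : p ≠ 2 := SylvesterTwoLower.ne_two_of_mod_nine h9
  refine (missingLowerBoundAt_two_iff_forall_powDivisible_le hω h2K hp hp2 B hB hqB hq0 hrank P hP hgen
    Y hu0 hu (SylvesterTwoYin.even_displayExponent p) hid).mpr fun j hdiv => ?_
  rw [padicValNat_shaOrder_eq_primaryComponent hHSY hp h9 h3 B hB]
  exact hlow hF p hp h9 h3 B hB qB hqB (CyclotomicField 3 ℚ) ω hω h2K P hP hgen Y u hu0 hu hid j hdiv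

/-- **The LIVE child 19891 `LowerOnV0HSY` BY NAME ⟸ Yin's display + (low)** (through the lossless split
`SylvesterTwoLowerSplit.lowerOfFacts_iff_onV0_and_offV0`, p471972; (low) proves the parent, so both
children — the `𝒱₀` condition is idle). A REDUCTION; (low) is open.
[cite: Miller2011LMS, §1 and Def. 1.1] [cite: HuShuYin2019, Thm. 1.3 / 1.4, pp. 8, 12] -/
theorem lowerOnV0HSY_of_yin_of_low (hY : SylvesterTwoYin.YinHeightDisplay)
    (hlow : Theses.SylvesterTwoHeegnerIndex.PublishedFactsTwo →
      ∀ (p : ℕ), p.Prime → (p % 9 = 4 ∨ p % 9 = 7) → (¬ ∃ x : ZMod p, x ^ 3 = 3) →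
      ∀ (B : WeierstrassCurve ℚ) [B.IsElliptic] [B.IsGloballyMinimal],
        (∃ C : VariableChange ℚ, C • B = cubeSumCurve (p : ℚ)) → ∀ (qB : ℚ), shaAn B = (qB : ℂ) →
      ∀ (K : Type) [Field K] [NumberField K] (ω : K), ω ^ 2 + ω + 1 = 0 → Module.finrank ℚ K = 2 →
      ∀ (P₀ : B.toAffine.Point), ¬ IsOfFinAddOrder (QuadraticDescent.incl K B P₀) →
        (∀ Q : B.toAffine.Point, ∃ m : ℤ,
          IsOfFinAddOrder (QuadraticDescent.incl K B Q - m • QuadraticDescent.incl K B P₀)) →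
      ∀ (Y : (B.baseChange K).toAffine.Point) (u : ℚ), u ≠ 0 → padicValRat 2 u = 0 →
        ((u * qB : ℚ) : ℝ) * canonicalHeight (QuadraticDescent.incl K B P₀) =
          (2 : ℝ) ^ (if p % 9 = 4 then (0 : ℤ) else -2) * canonicalHeight Y →
      ∀ j : ℕ, (∃ Y' T' : (B.baseChange K).toAffine.Point,
          IsOfFinAddOrder T' ∧ Y = ((2 : ℤ) ^ j) • Y' + T') →
        2 * (j : ℤ) + (if p % 9 = 4 then (0 : ℤ) else -2) ≤
          (padicValNat 2 (Nat.card (AddCommGroup.primaryComponent B.sha 2)) : ℤ)) :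
    Theses.SylvesterTwoHeegnerIndex.LowerOnV0HSY :=
  (SylvesterTwoLowerSplit.lowerOfFacts_iff_onV0_and_offV0.mp (lowerOfFacts_of_yin_of_low hY hlow)).1

/-- **The LIVE child 19892 `LowerOffV0HSY` BY NAME ⟸ Yin's display + (low)** (second conjunct of the
lossless split p471972). A REDUCTION; (low) is open.
[cite: Miller2011LMS, §1 and Def. 1.1] [cite: HuShuYin2019, Thm. 1.3 / 1.4, pp. 8, 12] -/
theorem lowerOffV0HSY_of_yin_of_low (hY : SylvesterTwoYin.YinHeightDisplay)
    (hlow : Theses.SylvesterTwoHeegnerIndex.PublishedFactsTwo →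
      ∀ (p : ℕ), p.Prime → (p % 9 = 4 ∨ p % 9 = 7) → (¬ ∃ x : ZMod p, x ^ 3 = 3) →
      ∀ (B : WeierstrassCurve ℚ) [B.IsElliptic] [B.IsGloballyMinimal],
        (∃ C : VariableChange ℚ, C • B = cubeSumCurve (p : ℚ)) → ∀ (qB : ℚ), shaAn B = (qB : ℂ) →
      ∀ (K : Type) [Field K] [NumberField K] (ω : K), ω ^ 2 + ω + 1 = 0 → Module.finrank ℚ K = 2 →
      ∀ (P₀ : B.toAffine.Point), ¬ IsOfFinAddOrder (QuadraticDescent.incl K B P₀) →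
        (∀ Q : B.toAffine.Point, ∃ m : ℤ,
          IsOfFinAddOrder (QuadraticDescent.incl K B Q - m • QuadraticDescent.incl K B P₀)) →
      ∀ (Y : (B.baseChange K).toAffine.Point) (u : ℚ), u ≠ 0 → padicValRat 2 u = 0 →
        ((u * qB : ℚ) : ℝ) * canonicalHeight (QuadraticDescent.incl K B P₀) =
          (2 : ℝ) ^ (if p % 9 = 4 then (0 : ℤ) else -2) * canonicalHeight Y →
      ∀ j : ℕ, (∃ Y' T' : (B.baseChange K).toAffine.Point,
          IsOfFinAddOrder T' ∧ Y = ((2 : ℤ) ^ j) • Y' + T') →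
        2 * (j : ℤ) + (if p % 9 = 4 then (0 : ℤ) else -2) ≤
          (padicValNat 2 (Nat.card (AddCommGroup.primaryComponent B.sha 2)) : ℤ)) :
    Theses.SylvesterTwoHeegnerIndex.LowerOffV0HSY :=
  (SylvesterTwoLowerSplit.lowerOfFacts_iff_onV0_and_offV0.mp (lowerOfFacts_of_yin_of_low hY hlow)).2

/-- **CONVERSELY (losslessness): 19477 + Yin's display ⟹ (low).** If the LOWER crux holds then, granted
`PublishedFactsTwo` and the display, at EVERY display datum `(K, P₀, Y, u)` of every member the point
`Y` is not too `2`-divisible: `Y ∈ 2^j·B(K) + tors ⟹ 2j + 2δ ≤ ord₂ #Ш(B)[2^∞]`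
(`missingLowerBoundAt_two_iff_forall_powDivisible_le`, `.mp`; the display supplies `rank_ℤ B(K) = 2`
and `qB ≠ 0` at that `K`). So (low) is EXACTLY the LOWER crux modulo the display — neither weaker nor
stronger. [cite: Miller2011LMS, §1 and Def. 1.1] [cite: HuShuYin2019, Thm. 1.3 / 1.4, pp. 8, 12] -/
theorem low_of_lowerOfFacts_of_yin
    (hlo : Theses.SylvesterTwoHeegnerIndex.HeegnerIndexLowerAtTwoHSYOfFacts)
    (hY : SylvesterTwoYin.YinHeightDisplay) :
    Theses.SylvesterTwoHeegnerIndex.PublishedFactsTwo →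
      ∀ (p : ℕ), p.Prime → (p % 9 = 4 ∨ p % 9 = 7) → (¬ ∃ x : ZMod p, x ^ 3 = 3) →
      ∀ (B : WeierstrassCurve ℚ) [B.IsElliptic] [B.IsGloballyMinimal],
        (∃ C : VariableChange ℚ, C • B = cubeSumCurve (p : ℚ)) → ∀ (qB : ℚ), shaAn B = (qB : ℂ) →
      ∀ (K : Type) [Field K] [NumberField K] (ω : K), ω ^ 2 + ω + 1 = 0 → Module.finrank ℚ K = 2 →
      ∀ (P₀ : B.toAffine.Point), ¬ IsOfFinAddOrder (QuadraticDescent.incl K B P₀) →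
        (∀ Q : B.toAffine.Point, ∃ m : ℤ,
          IsOfFinAddOrder (QuadraticDescent.incl K B Q - m • QuadraticDescent.incl K B P₀)) →
      ∀ (Y : (B.baseChange K).toAffine.Point) (u : ℚ), u ≠ 0 → padicValRat 2 u = 0 →
        ((u * qB : ℚ) : ℝ) * canonicalHeight (QuadraticDescent.incl K B P₀) =
          (2 : ℝ) ^ (if p % 9 = 4 then (0 : ℤ) else -2) * canonicalHeight Y →
      ∀ j : ℕ, (∃ Y' T' : (B.baseChange K).toAffine.Point,
          IsOfFinAddOrder T' ∧ Y = ((2 : ℤ) ^ j) • Y' + T') →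
        2 * (j : ℤ) + (if p % 9 = 4 then (0 : ℤ) else -2) ≤
          (padicValNat 2 (Nat.card (AddCommGroup.primaryComponent B.sha 2)) : ℤ) := by
  intro hF p hp h9 h3 B _ _ hB qB hqB K _ _ ω hω h2K P₀ hP hgen Y u hu0 hu hid j hdiv
  have hF' := hF
  obtain ⟨hHSY, -⟩ := hF'
  have hM : MissingLowerBoundAt B 2 :=
    SylvesterTwoLowerCert.lowerOfFacts_iff_forall_missingLowerBoundAt.mp hlo hF p hp h9 h3 B hB
  obtain ⟨qB', hqB', hq0', hrank, -⟩ := hY p hp h9 B hB K ω hω h2K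
  have e : qB' = qB := by exact_mod_cast hqB'.symm.trans hqB
  subst e
  have hp2 : p ≠ 2 := SylvesterTwoLower.ne_two_of_mod_nine h9
  have h := (missingLowerBoundAt_two_iff_forall_powDivisible_le hω h2K hp hp2 B hB hqB hq0' hrank P₀ hP
    hgen Y hu0 hu (SylvesterTwoYin.even_displayExponent p) hid).mp hM j hdiv
  rwa [padicValNat_shaOrder_eq_primaryComponent hHSY hp h9 h3 B hB] at h

/-- **THE LOWER CRUX OF K7t IS (low), modulo Yin's display** — `HeegnerIndexLowerAtTwoHSYOfFacts ↔ (low)`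
granted `YinHeightDisplay`. The kernel certificate for re-registering 19891/19892's residue stubs in
Yin currency (no twin, no `𝒱₀` / residue split; both classes `p ≡ 4, 7 (9)` at once). Nothing asserted
about either side. [cite: Miller2011LMS, §1 and Def. 1.1] [cite: HuShuYin2019, Thm. 1.3 / 1.4, pp. 8, 12] -/
theorem lowerOfFacts_iff_low_of_yin (hY : SylvesterTwoYin.YinHeightDisplay) :
    Theses.SylvesterTwoHeegnerIndex.HeegnerIndexLowerAtTwoHSYOfFacts ↔
      (Theses.SylvesterTwoHeegnerIndex.PublishedFactsTwo →
      ∀ (p : ℕ), p.Prime → (p % 9 = 4 ∨ p % 9 = 7) → (¬ ∃ x : ZMod p, x ^ 3 = 3) →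
      ∀ (B : WeierstrassCurve ℚ) [B.IsElliptic] [B.IsGloballyMinimal],
        (∃ C : VariableChange ℚ, C • B = cubeSumCurve (p : ℚ)) → ∀ (qB : ℚ), shaAn B = (qB : ℂ) →
      ∀ (K : Type) [Field K] [NumberField K] (ω : K), ω ^ 2 + ω + 1 = 0 → Module.finrank ℚ K = 2 →
      ∀ (P₀ : B.toAffine.Point), ¬ IsOfFinAddOrder (QuadraticDescent.incl K B P₀) →
        (∀ Q : B.toAffine.Point, ∃ m : ℤ,
          IsOfFinAddOrder (QuadraticDescent.incl K B Q - m • QuadraticDescent.incl K B P₀)) →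
      ∀ (Y : (B.baseChange K).toAffine.Point) (u : ℚ), u ≠ 0 → padicValRat 2 u = 0 →
        ((u * qB : ℚ) : ℝ) * canonicalHeight (QuadraticDescent.incl K B P₀) =
          (2 : ℝ) ^ (if p % 9 = 4 then (0 : ℤ) else -2) * canonicalHeight Y →
      ∀ j : ℕ, (∃ Y' T' : (B.baseChange K).toAffine.Point,
          IsOfFinAddOrder T' ∧ Y = ((2 : ℤ) ^ j) • Y' + T') →
        2 * (j : ℤ) + (if p % 9 = 4 then (0 : ℤ) else -2) ≤
          (padicValNat 2 (Nat.card (AddCommGroup.primaryComponent B.sha 2)) : ℤ)) :=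
  ⟨fun hlo => low_of_lowerOfFacts_of_yin hlo hY, fun hlow => lowerOfFacts_of_yin_of_low hY hlow⟩

end Summit.BirchSwinnertonDyer.BirchSwinnertonDyer.Theorems.SylvesterTwoYinLower

end
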